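import Literature.Analysis.FluidPDE.LerayHopf
import Literature.Analysis.FluidPDE.TaoClassGlobal

/-!
# Route TypeICertificateLadder — lemmas for `NoBlowupToClay` (item stmt-NavierStokesRegularity-0055)

Bookkeeping lemmas serving the proof of the shared frame item `NoBlowupToClay`
(`TypeICertificateLadderNoBlowupToClay.lean`):

* `isLerayHopfOn_update_initial` — the slice `u 0` of a Leray–Hopf weak solution of the unforced
  system is unconstrained by the definition; resetting it to the datum `u₀ ∈ L²` keeps the
  Leray–Hopf property (Leray 1934, §31; Galdi 2000, Def. 2.1);
* `isTaoSolutionOn_family_eq`, `exists_classical_of_isTaoSolutionOn_family` — Tao-class solutions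
  (`IsTaoSolutionOn`, Tao 2013, Thm. 5.4) from one datum on slabs `[0, Ts n]` are pairwise
  consistent (Prodi–Serrin weak–strong uniqueness, `IsTaoSolutionOn.eq_of_isTaoSolutionOn`, and
  `IsTaoSolutionOn.pressure_eq`) and patch, along an exhaustion `Ts n ↑ T`, to a classical solution
  on `[0, T)` (the "maximal interval of existence" bookkeeping of Lemarié-Rieusset 2016, Thm. 7.2,
  proof p. 147; cf. `IsTaoSolutionOn.global_of_nat` for the exhaustion of `[0, ∞)`).

## References

* J. Leray, Acta Math. 63 (1934), §31.
* G. P. Galdi, *An introduction to the Navier–Stokes initial-boundary value problem* (2000),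
  Def. 2.1.
* P. G. Lemarié-Rieusset, *The Navier–Stokes Problem in the 21st Century*, CRC 2016, Thm. 7.2.
* J. C. Robinson, J. L. Rodrigo, W. Sadowski, *The Three-Dimensional Navier–Stokes Equations*,
  CUP 2016, Thm. 8.19.
* T. Tao, Anal. PDE 6 (2013), Thm. 5.4.
-/

noncomputable section

open Literature.Analysis.FluidPDE MeasureTheory Set Function Filter Topology Metric
open scoped ENNReal NNReal InnerProductSpace RealInnerProductSpace Laplacian

namespace Summit.NavierStokesRegularity.NavierStokesRegularity.Theorems

/-! ### Leray–Hopf solutions: resetting the initial slice -/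

section UpdateInitial

variable {E : Type*} [NormedAddCommGroup E] [InnerProductSpace ℝ E] [FiniteDimensional ℝ E]
  [MeasurableSpace E] [BorelSpace E]

/-- **The slice `u 0` of a Leray–Hopf weak solution is unconstrained**: replacing it by the datum
`u₀ ∈ L²` keeps `u` a Leray–Hopf weak solution of the unforced system from `u₀`. Every clause of
the definition sees the slices either at positive times only (weak formulation on `(0, T)`,
`L^∞L²` bound, weak gradients, energy inequality from a.e. `s > 0`, weak/strong attainment of the
datum as `t → 0⁺`) or, at `t = 0`, through `u 0 ∈ L²` and the trivial instance
`E(u 0) ≤ E(u₀)` of the energy inequality (Leray 1934, §31; Galdi 2000, Def. 2.1). [folklore] -/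
theorem isLerayHopfOn_update_initial {T ν : ℝ} {u₀ : E → E} {u : ℝ → E → E}
    (hu : IsLerayHopfOn T ν 0 u₀ u) (hu₀ : MemLp u₀ 2 volume) :
    IsLerayHopfOn T ν 0 u₀ (fun t => if t = 0 then u₀ else u t) := by
  set v : ℝ → E → E := fun t => if t = 0 then u₀ else u t with hv_def
  have hv0 : v 0 = u₀ := by simp [hv_def]
  have hvpos : ∀ {t : ℝ}, 0 < t → v t = u t := fun {t} ht => by simp [hv_def, ht.ne']
  have hvz : ∀ z : ℝ × E, z.1 ∈ Ioo 0 T → uncurry v z = uncurry u z := by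
    rintro ⟨t, x⟩ ht
    simp only [uncurry_apply_pair, hvpos ht.1]
  obtain ⟨hmeas, hloc, hdiv, hweak⟩ := hu.weak
  refine
    { weak := ⟨?_, fun K hK => ?_, ?_, fun ψ hψ hψdiv => ?_⟩
      energy_bound := ?_
      memLp := fun t ht => ?_
      weakGrad_energy := ?_
      weak_continuous := fun w hw => ?_
      strong_initial := ?_ }
  · -- measurability on the strip `(0, T) × E`
    refine hmeas.congr ?_
    filter_upwards [ae_restrict_mem (measurableSet_Ioo.prod MeasurableSet.univ)] with z hz
    exact (hvz z hz.1).symm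
  · -- local square integrability
    rw [setLIntegral_congr_fun (measurableSet_Ioo.prod hK.measurableSet)
      (fun z hz => by rw [hvz z hz.1])]
    exact hloc K hK
  · -- weak divergence-freeness of a.e. slice
    filter_upwards [hdiv, ae_restrict_mem measurableSet_Ioo] with t ht htI
    rw [hvpos htI.1]
    exact ht
  · -- the weak identity: the time integral is over `(0, T)`
    have key : ∫ t in Ioo 0 T, ∫ x, (⟪v t x, timeDeriv ψ t x⟫ + ⟪v t x, convect (v t) (ψ t) x⟫ +
        ν * ⟪v t x, Δ (ψ t) x⟫ + ⟪(0 : ℝ → E → E) t x, ψ t x⟫) =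
        ∫ t in Ioo 0 T, ∫ x, (⟪u t x, timeDeriv ψ t x⟫ + ⟪u t x, convect (u t) (ψ t) x⟫ +
        ν * ⟪u t x, Δ (ψ t) x⟫ + ⟪(0 : ℝ → E → E) t x, ψ t x⟫) :=
      setIntegral_congr_fun measurableSet_Ioo fun t ht => by rw [hvpos ht.1]
    rw [key]
    exact hweak ψ hψ hψdiv
  · -- `L^∞(0, T; L²)`
    obtain ⟨C, hC⟩ := hu.energy_bound
    refine ⟨C, ?_⟩
    filter_upwards [hC, ae_restrict_mem measurableSet_Ioo] with t ht htI
    rw [hvpos htI.1]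
    exact ht
  · -- every slice in `L²`
    rcases eq_or_lt_of_le ht.1 with h0 | hpos
    · rw [← h0, hv0]
      exact hu₀
    · rw [hvpos hpos]
      exact hu.memLp t ht
  · -- weak gradient and the energy inequalities
    obtain ⟨G, hG, hG2, hE0, hEs⟩ := hu.weakGrad_energy
    refine ⟨G, ?_, hG2, fun t ht => ?_, ?_⟩
    · filter_upwards [hG, ae_restrict_mem measurableSet_Ioo] with t ht htI
      rw [hvpos htI.1]
      exact ht
    · rcases eq_or_lt_of_le ht.1 with h0 | hpos
      · subst h0
        rw [hv0]
        simp
      · have h := hE0 t ht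
        simp only [Pi.zero_apply, inner_zero_left, integral_zero,
          intervalIntegral.integral_zero, add_zero] at h ⊢
        rw [hvpos hpos]
        exact h
    · filter_upwards [hEs, ae_restrict_mem measurableSet_Ioo] with s hs hsI
      intro t ht
      have h := hs t ht
      simp only [Pi.zero_apply, inner_zero_left, integral_zero,
        intervalIntegral.integral_zero, add_zero] at h ⊢
      rw [hvpos hsI.1, hvpos (hsI.1.trans_le ht.1)]
      exact h
  · -- weak continuity into `L²` on `(0, T]` and weak attainment of the datum
    obtain ⟨hc, h0⟩ := hu.weak_continuous w hw
    refine ⟨hc.congr fun t ht => ?_, h0.congr' ?_⟩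
    · show ∫ x, ⟪v t x, w x⟫ = ∫ x, ⟪u t x, w x⟫
      rw [hvpos ht.1]
    · filter_upwards [self_mem_nhdsWithin] with t ht
      show ∫ x, ⟪u t x, w x⟫ = ∫ x, ⟪v t x, w x⟫
      rw [hvpos ht]
  · -- strong attainment of the datum
    refine hu.strong_initial.congr' ?_
    filter_upwards [self_mem_nhdsWithin] with t ht
    show eLpNorm (u t - u₀) 2 volume = eLpNorm (v t - u₀) 2 volume
    rw [hvpos ht]

end UpdateInitial

/-! ### Patching Tao-class solutions along an exhaustion `Tₙ ↑ T` -/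

/-- **Consistency of Tao-class solutions from one datum on a family of slabs.** If `(u n, p n)`
is a Tao-class solution on `[0, Ts n]` from `u₀` for every `n`, then `u n t = u m t` and
`p n t = p m t` for `0 ≤ t < min (Ts n) (Ts m)`: velocities by Prodi–Serrin weak–strong
uniqueness (`IsTaoSolutionOn.eq_of_isTaoSolutionOn`), then the `L²` pressures on a closed slab
`[0, s]` beyond `t` (`IsTaoSolutionOn.pressure_eq`).
[cite: RobinsonRodrigoSadowski2016, Thm. 8.19] -/
theorem isTaoSolutionOn_family_eq {ν : ℝ} (hν : 0 < ν)
    {u₀ : EuclideanSpace ℝ (Fin 3) → EuclideanSpace ℝ (Fin 3)} {Ts : ℕ → ℝ} (hTs0 : ∀ n, 0 < Ts n)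
    {u : ℕ → ℝ → EuclideanSpace ℝ (Fin 3) → EuclideanSpace ℝ (Fin 3)}
    {p : ℕ → ℝ → EuclideanSpace ℝ (Fin 3) → ℝ}
    (h : ∀ n, IsTaoSolutionOn (Ts n) ν u₀ (u n) (p n)) {n m : ℕ} {t : ℝ} (ht0 : 0 ≤ t)
    (htn : t < Ts n) (htm : t < Ts m) : u n t = u m t ∧ p n t = p m t := by
  have hV : ∀ s ∈ Ico 0 (min (Ts n) (Ts m)), u n s = u m s :=
    IsTaoSolutionOn.eq_of_isTaoSolutionOn (h n) (h m) hν (hTs0 n) (hTs0 m)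
  refine ⟨hV t ⟨ht0, lt_min htn htm⟩, ?_⟩
  set μ : ℝ := min (Ts n) (Ts m) with hμ
  have htμ : t < μ := lt_min htn htm
  set s : ℝ := (t + μ) / 2 with hs
  have hs0 : 0 < s := by rw [hs]; linarith
  have hsμ : s < μ := by rw [hs]; linarith
  have hts : t ≤ s := by rw [hs]; linarith
  have hsn : s ≤ Ts n := (hsμ.trans_le (min_le_left _ _)).le
  have hsm : s ≤ Ts m := (hsμ.trans_le (min_le_right _ _)).le
  have hVs : ∀ r ∈ Icc 0 s, u n r = u m r := fun r hr => hV r ⟨hr.1, hr.2.trans_lt hsμ⟩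
  exact IsTaoSolutionOn.pressure_eq (h n) (h m) hs0 hsn hsm hVs t ⟨ht0, hts⟩

/-- **Patching Tao-class solutions along an exhaustion.** Let `(u n, p n)` be Tao-class solutions
on `[0, Ts n]` from `u₀`, `0 < Ts n ≤ T`, the `Ts n` exhausting `[0, T)`. Selecting at each time
the solution of least index alive there gives a classical solution `(U, P)` of the unforced
Navier–Stokes system on `ℝ³ × [0, T)` with `U 0 = u₀`, equal to `(u n, p n)` on `[0, Ts n)` for
every `n`: the pieces are consistent (`isTaoSolutionOn_family_eq`), joint smoothness is local, and
the one-sided time derivative within `[0, T)` at `t < Ts n` is the one within `[0, Ts n)`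
(`derivWithin_inter`). This is the "maximal interval of existence" bookkeeping of
Lemarié-Rieusset 2016, Thm. 7.2 (proof, p. 147).
[cite: LemarieRieusset2016, Thm. 7.2 (proof), PDF p. 147] -/
theorem exists_classical_of_isTaoSolutionOn_family {ν : ℝ} (hν : 0 < ν)
    {u₀ : EuclideanSpace ℝ (Fin 3) → EuclideanSpace ℝ (Fin 3)} {T : ℝ} {Ts : ℕ → ℝ}
    (hTs0 : ∀ n, 0 < Ts n) (hTsT : ∀ n, Ts n ≤ T) (hcof : ∀ t < T, ∃ n, t < Ts n)
    {u : ℕ → ℝ → EuclideanSpace ℝ (Fin 3) → EuclideanSpace ℝ (Fin 3)}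
    {p : ℕ → ℝ → EuclideanSpace ℝ (Fin 3) → ℝ} (h : ∀ n, IsTaoSolutionOn (Ts n) ν u₀ (u n) (p n)) :
    ∃ (U : ℝ → EuclideanSpace ℝ (Fin 3) → EuclideanSpace ℝ (Fin 3))
      (P : ℝ → EuclideanSpace ℝ (Fin 3) → ℝ),
      IsClassicalNSSolutionOn (Ico 0 T) ν 0 U P ∧ U 0 = u₀ ∧
        ∀ n, ∀ t ∈ Ico 0 (Ts n), U t = u n t ∧ P t = p n t := by
  classical
  let U : ℝ → EuclideanSpace ℝ (Fin 3) → EuclideanSpace ℝ (Fin 3) := fun t =>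
    if ht : ∃ m, t < Ts m then u (Nat.find ht) t else u 0 t
  let P : ℝ → EuclideanSpace ℝ (Fin 3) → ℝ := fun t =>
    if ht : ∃ m, t < Ts m then p (Nat.find ht) t else p 0 t
  have hU : ∀ n, ∀ t ∈ Ico 0 (Ts n), U t = u n t ∧ P t = p n t := fun n t ht => by
    have hex : ∃ m, t < Ts m := ⟨n, ht.2⟩
    have hfs := Nat.find_spec hex
    simp only [U, P, dif_pos hex]
    exact isTaoSolutionOn_family_eq hν hTs0 h ht.1 hfs ht.2
  -- the relatively open pieces `[0, Ts n) = [0, T) ∩ (-∞, Ts n)`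
  have hpiece : ∀ n, Ico 0 T ∩ Iio (Ts n) = Ico 0 (Ts n) := fun n => by
    rw [Ico_inter_Iio, min_eq_right (hTsT n)]
  have hcl : ∀ n, IsClassicalNSSolutionOn (Ico 0 (Ts n)) ν 0 (u n) (p n) := fun n =>
    (h n).classical.mono Ico_subset_Icc_self (uniqueDiffOn_Ico 0 (Ts n))
  -- joint smoothness is local along the exhaustion
  have hsmooth : ∀ {F : Type} [NormedAddCommGroup F] [NormedSpace ℝ F]
      {g : ℝ → EuclideanSpace ℝ (Fin 3) → F} {gs : ℕ → ℝ → EuclideanSpace ℝ (Fin 3) → F},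
      (∀ n, IsSmoothSpaceTimeOn (Icc 0 (Ts n)) (gs n)) →
      (∀ n, ∀ t ∈ Ico 0 (Ts n), g t = gs n t) → IsSmoothSpaceTimeOn (Ico 0 T) g := by
    intro F _ _ g gs hgs heq
    refine contDiffOn_of_locally_contDiffOn fun z hz => ?_
    obtain ⟨t, x⟩ := z
    obtain ⟨n, hn⟩ := hcof t hz.1.2
    refine ⟨Iio (Ts n) ×ˢ univ, isOpen_Iio.prod isOpen_univ, ⟨hn, mem_univ _⟩, ?_⟩
    rw [prod_inter_prod, univ_inter, hpiece n]
    refine ((hgs n).mono Ico_subset_Icc_self).congr fun z hz => ?_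
    obtain ⟨τ, y⟩ := z
    simp only [uncurry_apply_pair, heq n τ hz.1]
  refine ⟨U, P, ⟨?_, ?_, fun t ht x => ?_, fun t ht => ?_⟩, ?_, hU⟩
  · exact hsmooth (fun n => (h n).classical.smooth_velocity) fun n t ht => (hU n t ht).1
  · exact hsmooth (fun n => (h n).classical.smooth_pressure) fun n t ht => (hU n t ht).2
  · -- momentum: the one-sided derivative within `[0, T)` is the one within `[0, Ts n)`
    obtain ⟨n, hn⟩ := hcof t ht.2
    have htn : t ∈ Ico 0 (Ts n) := ⟨ht.1, hn⟩
    have hD : timeDerivWithin (Ico 0 T) U t x = timeDerivWithin (Ico 0 (Ts n)) (u n) t x := by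
      simp only [timeDerivWithin_apply]
      rw [← derivWithin_inter (Iio_mem_nhds hn), hpiece n]
      exact derivWithin_congr (fun s hs => congrFun (hU n s hs).1 x) (congrFun (hU n t htn).1 x)
    rw [hD, (hU n t htn).1, (hU n t htn).2]
    exact (hcl n).momentum t htn x
  · obtain ⟨n, hn⟩ := hcof t ht.2
    rw [(hU n t ⟨ht.1, hn⟩).1]
    exact (hcl n).divFree t ⟨ht.1, hn⟩
  · rw [(hU 0 0 ⟨le_rfl, hTs0 0⟩).1]
    exact (h 0).initial

end Summit.NavierStokesRegularity.NavierStokesRegularity.Theorems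

end
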